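import Literature.NumberTheory.EllipticCurves.SqrtTwoTwistEightTorsion
import Literature.NumberTheory.EllipticCurves.X049FrobeniusTraces
import Literature.NumberTheory.EllipticCurves.FrobeniusManinProofs
import Literature.NumberTheory.EllipticCurves.FrobeniusTateModule
import HarnessLib

/-!
# The `√−7`-torsion Frobenius argument on `49a1`: `a_p(X₀(49)) ≡ p² + p⁵ (mod 7)` — the sign in Deuring's theorem for `j = −3375`

Topic `Literature/NumberTheory/EllipticCurves`, namespace `Literature.NumberTheory.EllipticCurves.X049.SevenTorsion` (tools) and
`…X049` (the congruence); sequel of `X049FrobeniusTraces` (the model `E = 49a1 = ⟨1, −1, 0, −2, −1⟩` and the named group-order formula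
`groupOrder_A7`), sibling of `SqrtTwoTwistEightTorsion` / `SqrtTwoTwistBrewerTheorem` (the same method for `j = 8000`).  THEOREMS ONLY.

The kernel `C = E[√−7]` of the rational `7`-isogeny of `E` is cyclic of order `7` with points in `ℚ(ζ₇)`:
`P₁ = (ζ⁴ + ζ³, ζ² − ζ⁵ − ζ⁴)`, `P₂ = 2P₁ = (ζ⁵ + ζ², ζ⁵ + ζ⁴ + ζ³ + 2ζ + 1)`, `P₄ = 4P₁ = (−ζ⁵ − ζ⁴ − ζ³ − ζ² − 1, ζ⁴ − ζ³ − ζ)`,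
`2P₄ = P₁` (so `7P₁ = O`), and `Gal(ℚ(ζ₇)/ℚ) ∋ (ζ ↦ ζ^r)` acts on `C` as multiplication by `r⁻¹ (mod 7)`.  All of this is a finite list of
polynomial identities modulo `Φ₇(ζ) = ζ⁶ + ⋯ + ζ + 1` (certificates computed once in PARI/GP, job `j318946`, and CHECKED here by
`linear_combination`), valid in every field containing a root `ζ` of `Φ₇` with `7 ≠ 0` — in particular in `\bar 𝔽_p`, `p ≠ 7`, where the
`p`-Frobenius `σ` acts on `P₁` through `ζ ↦ ζ^p`.  With the tree's ELEMENTARY pointwise relation `σ²T − a_p σT + pT = O`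
(`WeierstrassCurve.frobenius_sq_sub_trace_smul_add_card_smul`, Manin) at `T = P₁` (order `7`, `σP₁ = k P₁`, `k ≡ p⁻¹`):
`7 ∣ k² − a_p k + p`, i.e. **`a_p(E) ≡ p⁻¹ + p² ≡ p⁵ + p² (mod 7)`** for every prime `p ≠ 2, 7` (`frobeniusTrace_E_mod_seven`; for split `p`
this is a non-zero square mod `7`, which is exactly the sign `(u/7) = +1` in `a_p = (u/7)·u`, `4p = u² + 7v²` — discharged in
`X049GroupOrderHoldsProofs`).

References: Silverman *AEC* III.2.3 (group law), V.2.3.1 (`φ² − aφ + q = 0`); Gross, *Arithmetic on elliptic curves with complex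
multiplication*, LNM 776, §§11–12 (the `√−p`-division points of `A(p)`); Rajwade 1977, Thm. 3; Silverberg 2010, (2.1).
-/

noncomputable section

open scoped Classical

namespace Literature.NumberTheory.EllipticCurves

namespace X049

namespace SevenTorsion

open _root_.WeierstrassCurve Literature.NumberTheory.EllipticCurves.SqrtTwoTwist.EightTorsion

section GroupLaw

variable {F : Type*} [Field F] {V : WeierstrassCurve F}
  (h₁ : V.a₁ = 1) (h₂ : V.a₂ = -1) (h₃ : V.a₃ = 0) (h₄ : V.a₄ = -2) (h₆ : V.a₆ = -1)
include h₁ h₂ h₃ h₄ h₆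

/-- `equation_iff'`: explicit identity / group-law step on `49a1 : y² + xy = x³ − x² − 2x − 1` (see the module docstring). [cite: SilvermanAEC2009, III.2.3] -/
theorem equation_iff' (x y : F) : V.toAffine.Equation x y ↔ y ^ 2 + x * y = x ^ 3 - x ^ 2 - 2 * x - 1 := by
  rw [Affine.equation_iff, h₁, h₂, h₃, h₄, h₆]
  constructor <;> intro h <;> linear_combination h

/-- `Δ_eq`: explicit identity / group-law step on `49a1 : y² + xy = x³ − x² − 2x − 1` (see the module docstring). [cite: SilvermanAEC2009, III.2.3] -/
theorem Δ_eq : V.Δ = -343 := by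
  simp only [WeierstrassCurve.Δ, WeierstrassCurve.b₂, WeierstrassCurve.b₄, WeierstrassCurve.b₆,
    WeierstrassCurve.b₈, h₁, h₂, h₃, h₄, h₆]
  norm_num

/-- `nonsingular_of_eq`: explicit identity / group-law step on `49a1 : y² + xy = x³ − x² − 2x − 1` (see the module docstring). [cite: SilvermanAEC2009, III.2.3] -/
theorem nonsingular_of_eq (h7 : (7 : F) ≠ 0) {x y : F} (h : y ^ 2 + x * y = x ^ 3 - x ^ 2 - 2 * x - 1) :
    V.toAffine.Nonsingular x y := by
  have hΔ : V.Δ ≠ 0 := by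
    rw [Δ_eq h₁ h₂ h₃ h₄ h₆, show (-343 : F) = -(7 ^ 3) by norm_num, neg_ne_zero]; exact pow_ne_zero _ h7
  exact (Affine.equation_iff_nonsingular_of_Δ_ne_zero hΔ).mp ((equation_iff' h₁ h₂ h₃ h₄ h₆ x y).mpr h)

omit h₂ h₄ h₆ in
/-- `negY_eq`: explicit identity / group-law step on `49a1 : y² + xy = x³ − x² − 2x − 1` (see the module docstring). [cite: SilvermanAEC2009, III.2.3] -/
theorem negY_eq (x y : F) : V.toAffine.negY x y = -y - x := by
  rw [Affine.negY, h₁, h₃]; ring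

omit h₃ h₄ h₆ in
/-- `addX_eq`: explicit identity / group-law step on `49a1 : y² + xy = x³ − x² − 2x − 1` (see the module docstring). [cite: SilvermanAEC2009, III.2.3] -/
theorem addX_eq (x₁ x₂ ℓ : F) : V.toAffine.addX x₁ x₂ ℓ = ℓ ^ 2 + ℓ + 1 - x₁ - x₂ := by
  rw [Affine.addX, h₁, h₂]; ring

omit h₄ h₆ in
/-- `addY_eq`: explicit identity / group-law step on `49a1 : y² + xy = x³ − x² − 2x − 1` (see the module docstring). [cite: SilvermanAEC2009, III.2.3] -/
theorem addY_eq (x₁ x₂ y₁ ℓ : F) :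
    V.toAffine.addY x₁ x₂ y₁ ℓ = -(ℓ * (ℓ ^ 2 + ℓ + 1 - x₁ - x₂ - x₁) + y₁) - (ℓ ^ 2 + ℓ + 1 - x₁ - x₂) := by
  rw [Affine.addY, Affine.negY, Affine.negAddY, addX_eq h₁ h₂, h₁, h₃]; ring

omit h₂ h₄ h₆ in
/-- `neg_pt`: explicit identity / group-law step on `49a1 : y² + xy = x³ − x² − 2x − 1` (see the module docstring). [cite: SilvermanAEC2009, III.2.3] -/
theorem neg_pt {x y : F} (h : V.toAffine.Nonsingular x y) (h' : V.toAffine.Nonsingular x (-y - x)) :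
    -(Affine.Point.some x y h : V.toAffine.Point) = .some x (-y - x) h' := by
  rw [Affine.Point.neg_some]; exact pt_eq rfl (negY_eq h₁ h₃ x y)

omit h₆ in
/-- **Certified doubling**: `(x, y) + (x, y) = (X, Y)` on `(1, −1, 0, −2, −1)` from the two polynomial certificates `hX`, `hY` (the duplication
formula with denominators cleared, `D = 2y + x ≠ 0`, `N = 3x² − 2x − 2 − y`). [cite: SilvermanAEC2009, III.2.3 (duplication formula)] -/
theorem add_self_of_cert {x y X Y : F} (hP : V.toAffine.Nonsingular x y) (hQ : V.toAffine.Nonsingular X Y)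
    (hD : 2 * y + x ≠ 0)
    (hX : (3 * x ^ 2 - 2 * x - 2 - y) ^ 2 + (3 * x ^ 2 - 2 * x - 2 - y) * (2 * y + x) + (1 - 2 * x) * (2 * y + x) ^ 2
      = X * (2 * y + x) ^ 2)
    (hY : -((3 * x ^ 2 - 2 * x - 2 - y) * (X - x) + y * (2 * y + x)) - X * (2 * y + x) = Y * (2 * y + x)) :
    (Affine.Point.some x y hP : V.toAffine.Point) + .some x y hP = .some X Y hQ := by
  have hneg : V.toAffine.negY x y = -y - x := negY_eq h₁ h₃ _ _
  have hyne : y ≠ V.toAffine.negY x y := by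
    rw [hneg]; intro h; apply hD; linear_combination h
  rw [Affine.Point.add_self_of_Y_ne hyne]
  set ℓ := V.toAffine.slope x x y y with hℓdef
  have hℓ : ℓ = (3 * x ^ 2 + 2 * V.a₂ * x + V.a₄ - V.a₁ * y) / (y - V.toAffine.negY x y) := by
    rw [hℓdef, Affine.slope_of_Y_ne rfl hyne]
  rw [hneg, h₁, h₂, h₄] at hℓ
  have hℓD : ℓ * (2 * y + x) = 3 * x ^ 2 - 2 * x - 2 - y := by
    rw [hℓ, show y - (-y - x) = 2 * y + x by ring, div_mul_cancel₀ _ hD]; ring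
  have hXe : V.toAffine.addX x x ℓ = X := by
    rw [addX_eq h₁ h₂]
    have e : (ℓ ^ 2 + ℓ + 1 - x - x) * (2 * y + x) ^ 2 = X * (2 * y + x) ^ 2 := by
      rw [← hX]; linear_combination (ℓ * (2 * y + x) + (3 * x ^ 2 - 2 * x - 2 - y) + (2 * y + x)) * hℓD
    exact mul_right_cancel₀ (pow_ne_zero 2 hD) e
  have hYe : V.toAffine.addY x x y ℓ = Y := by
    rw [addY_eq h₁ h₂ h₃, ← addX_eq h₁ h₂, hXe]
    have e : (-(ℓ * (X - x) + y) - X) * (2 * y + x) = Y * (2 * y + x) := by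
      rw [← hY]; linear_combination -(X - x) * hℓD
    exact mul_right_cancel₀ hD e
  exact pt_eq hXe hYe

end GroupLaw

section Zeta

variable {F : Type*} [Field F] {ζ : F} (hΦ : ζ ^ 6 + ζ ^ 5 + ζ ^ 4 + ζ ^ 3 + ζ ^ 2 + ζ + 1 = 0)
include hΦ

/-- `zeta_pow_seven`: explicit identity / group-law step on `49a1 : y² + xy = x³ − x² − 2x − 1` (see the module docstring). [cite: SilvermanAEC2009, III.2.3] -/
theorem zeta_pow_seven : ζ ^ 7 = 1 := by linear_combination (ζ - 1) * hΦ

/-- `P₁ = (ζ⁴ + ζ³, ζ² − ζ⁵ − ζ⁴)` lies on `49a1` (identity modulo `Φ₇(ζ) = 0`). [cite: SilvermanAEC2009, III.2.3] -/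
theorem onCurve₁ : (ζ ^ 2 - ζ ^ 5 - ζ ^ 4) ^ 2 + (ζ ^ 4 + ζ ^ 3) * (ζ ^ 2 - ζ ^ 5 - ζ ^ 4) =
    (ζ ^ 4 + ζ ^ 3) ^ 3 - (ζ ^ 4 + ζ ^ 3) ^ 2 - 2 * (ζ ^ 4 + ζ ^ 3) - 1 := by
  linear_combination (-ζ ^ 6 - 2 * ζ ^ 5 + ζ ^ 4 + 2 * ζ ^ 3 - ζ + 1) * hΦ

/-- `onCurve₂`: explicit identity / group-law step on `49a1 : y² + xy = x³ − x² − 2x − 1` (see the module docstring). [cite: SilvermanAEC2009, III.2.3] -/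
theorem onCurve₂ : (ζ ^ 5 + ζ ^ 4 + ζ ^ 3 + 2 * ζ + 1) ^ 2 + (ζ ^ 5 + ζ ^ 2) * (ζ ^ 5 + ζ ^ 4 + ζ ^ 3 + 2 * ζ + 1) =
    (ζ ^ 5 + ζ ^ 2) ^ 3 - (ζ ^ 5 + ζ ^ 2) ^ 2 - 2 * (ζ ^ 5 + ζ ^ 2) - 1 := by
  linear_combination (-ζ ^ 9 + ζ ^ 8 - 3 * ζ ^ 6 + 3 * ζ ^ 5 + 3 * ζ ^ 4 - 3 * ζ ^ 3 + 3 * ζ ^ 2 + 2 * ζ + 2) * hΦ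

/-- `onCurve₄`: explicit identity / group-law step on `49a1 : y² + xy = x³ − x² − 2x − 1` (see the module docstring). [cite: SilvermanAEC2009, III.2.3] -/
theorem onCurve₄ : (ζ ^ 4 - ζ ^ 3 - ζ) ^ 2 + (-ζ ^ 5 - ζ ^ 4 - ζ ^ 3 - ζ ^ 2 - 1) * (ζ ^ 4 - ζ ^ 3 - ζ) =
    (-ζ ^ 5 - ζ ^ 4 - ζ ^ 3 - ζ ^ 2 - 1) ^ 3 - (-ζ ^ 5 - ζ ^ 4 - ζ ^ 3 - ζ ^ 2 - 1) ^ 2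
      - 2 * (-ζ ^ 5 - ζ ^ 4 - ζ ^ 3 - ζ ^ 2 - 1) - 1 := by
  linear_combination (ζ ^ 9 + 2 * ζ ^ 8 + 3 * ζ ^ 7 + 4 * ζ ^ 6 + 2 * ζ ^ 5 + 4 * ζ ^ 4 + ζ ^ 3 + 3 * ζ ^ 2 + 1) * hΦ

/-- `D₁ · e₁ = 7` for the tangent denominator `D₁ = 2y₁ + x₁` (so `D₁ ≠ 0` in characteristic `≠ 7`). [cite: SilvermanAEC2009, III.2.3] -/
theorem D₁_mul : (2 * (ζ ^ 2 - ζ ^ 5 - ζ ^ 4) + (ζ ^ 4 + ζ ^ 3)) * (3 * ζ ^ 5 + 2 * ζ ^ 3 - ζ ^ 2 + 2 * ζ + 1) = 7 := by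
  linear_combination (-6 * ζ ^ 4 + 3 * ζ ^ 3 + 2 * ζ ^ 2 + 7 * ζ - 7) * hΦ

/-- `D₂_mul`: explicit identity / group-law step on `49a1 : y² + xy = x³ − x² − 2x − 1` (see the module docstring). [cite: SilvermanAEC2009, III.2.3] -/
theorem D₂_mul : (2 * (ζ ^ 5 + ζ ^ 4 + ζ ^ 3 + 2 * ζ + 1) + (ζ ^ 5 + ζ ^ 2)) * (-ζ ^ 5 - ζ ^ 4 - 3 * ζ ^ 3 - 3 * ζ ^ 2 - 4 * ζ - 2) = 7 := by
  linear_combination (-3 * ζ ^ 4 - 2 * ζ ^ 3 - 8 * ζ ^ 2 - 5 * ζ - 11) * hΦ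

/-- `D₄_mul`: explicit identity / group-law step on `49a1 : y² + xy = x³ − x² − 2x − 1` (see the module docstring). [cite: SilvermanAEC2009, III.2.3] -/
theorem D₄_mul : (2 * (ζ ^ 4 - ζ ^ 3 - ζ) + (-ζ ^ 5 - ζ ^ 4 - ζ ^ 3 - ζ ^ 2 - 1)) * (-2 * ζ ^ 5 - 3 * ζ ^ 4 + ζ ^ 3 - 2 * ζ - 1) = 7 := by
  linear_combination (2 * ζ ^ 4 - ζ ^ 3 + ζ ^ 2 + 10 * ζ - 6) * hΦ

/-- Doubling certificate `2P₁ = P₂`, `x`-part. [cite: SilvermanAEC2009, III.2.3 (duplication formula)] -/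
theorem dbl₁₂X : (3 * (ζ ^ 4 + ζ ^ 3) ^ 2 - 2 * (ζ ^ 4 + ζ ^ 3) - 2 - (ζ ^ 2 - ζ ^ 5 - ζ ^ 4)) ^ 2
    + (3 * (ζ ^ 4 + ζ ^ 3) ^ 2 - 2 * (ζ ^ 4 + ζ ^ 3) - 2 - (ζ ^ 2 - ζ ^ 5 - ζ ^ 4)) * (2 * (ζ ^ 2 - ζ ^ 5 - ζ ^ 4) + (ζ ^ 4 + ζ ^ 3))
    + (1 - 2 * (ζ ^ 4 + ζ ^ 3)) * (2 * (ζ ^ 2 - ζ ^ 5 - ζ ^ 4) + (ζ ^ 4 + ζ ^ 3)) ^ 2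
    = (ζ ^ 5 + ζ ^ 2) * (2 * (ζ ^ 2 - ζ ^ 5 - ζ ^ 4) + (ζ ^ 4 + ζ ^ 3)) ^ 2 := by
  linear_combination (9 * ζ ^ 10 + 23 * ζ ^ 9 + 10 * ζ ^ 8 - 19 * ζ ^ 7 - 19 * ζ ^ 6 - 6 * ζ ^ 5 + 3 * ζ ^ 4 + 6 * ζ ^ 3 - 4 * ζ + 4) * hΦ

/-- `dbl₁₂Y`: explicit identity / group-law step on `49a1 : y² + xy = x³ − x² − 2x − 1` (see the module docstring). [cite: SilvermanAEC2009, III.2.3] -/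
theorem dbl₁₂Y : -((3 * (ζ ^ 4 + ζ ^ 3) ^ 2 - 2 * (ζ ^ 4 + ζ ^ 3) - 2 - (ζ ^ 2 - ζ ^ 5 - ζ ^ 4)) * ((ζ ^ 5 + ζ ^ 2) - (ζ ^ 4 + ζ ^ 3))
      + (ζ ^ 2 - ζ ^ 5 - ζ ^ 4) * (2 * (ζ ^ 2 - ζ ^ 5 - ζ ^ 4) + (ζ ^ 4 + ζ ^ 3)))
    - (ζ ^ 5 + ζ ^ 2) * (2 * (ζ ^ 2 - ζ ^ 5 - ζ ^ 4) + (ζ ^ 4 + ζ ^ 3))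
    = (ζ ^ 5 + ζ ^ 4 + ζ ^ 3 + 2 * ζ + 1) * (2 * (ζ ^ 2 - ζ ^ 5 - ζ ^ 4) + (ζ ^ 4 + ζ ^ 3)) := by
  linear_combination (-3 * ζ ^ 7 + 9 * ζ ^ 5 + ζ ^ 4 - 7 * ζ ^ 3) * hΦ

/-- Galois action `ζ ↦ ζ²`: `x₁(ζ²) = x₄`. [cite: SilvermanAEC2009, III.§7] -/
theorem gal₂X : (ζ ^ 2) ^ 4 + (ζ ^ 2) ^ 3 = -ζ ^ 5 - ζ ^ 4 - ζ ^ 3 - ζ ^ 2 - 1 := by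
  linear_combination (ζ ^ 2 - ζ + 1) * hΦ
/-- `gal₂Y`: explicit identity / group-law step on `49a1 : y² + xy = x³ − x² − 2x − 1` (see the module docstring). [cite: SilvermanAEC2009, III.2.3] -/
theorem gal₂Y : (ζ ^ 2) ^ 2 - (ζ ^ 2) ^ 5 - (ζ ^ 2) ^ 4 = ζ ^ 4 - ζ ^ 3 - ζ := by
  linear_combination (-ζ ^ 4 + ζ ^ 3 - ζ ^ 2 + ζ) * hΦ
/-- Galois action `ζ ↦ ζ³`: `x₁(ζ³) = x₂` (target `−P₂`). [cite: SilvermanAEC2009, III.§7] -/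
theorem gal₃X : (ζ ^ 3) ^ 4 + (ζ ^ 3) ^ 3 = ζ ^ 5 + ζ ^ 2 := by
  linear_combination (ζ ^ 6 - ζ ^ 5 + ζ ^ 3 - ζ ^ 2) * hΦ
/-- `gal₃Y`: explicit identity / group-law step on `49a1 : y² + xy = x³ − x² − 2x − 1` (see the module docstring). [cite: SilvermanAEC2009, III.2.3] -/
theorem gal₃Y : (ζ ^ 3) ^ 2 - (ζ ^ 3) ^ 5 - (ζ ^ 3) ^ 4 = -(ζ ^ 5 + ζ ^ 4 + ζ ^ 3 + 2 * ζ + 1) - (ζ ^ 5 + ζ ^ 2) := by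
  linear_combination (-ζ ^ 9 + ζ ^ 8 - ζ ^ 6 + ζ ^ 5 - ζ ^ 2 + ζ + 1) * hΦ
/-- Galois action `ζ ↦ ζ⁴`: `x₁(ζ⁴) = x₂` (target `P₂`). [cite: SilvermanAEC2009, III.§7] -/
theorem gal₄X : (ζ ^ 4) ^ 4 + (ζ ^ 4) ^ 3 = ζ ^ 5 + ζ ^ 2 := by
  linear_combination (ζ ^ 10 - ζ ^ 9 + ζ ^ 6 - ζ ^ 5 + ζ ^ 3 - ζ ^ 2) * hΦ
/-- `gal₄Y`: explicit identity / group-law step on `49a1 : y² + xy = x³ − x² − 2x − 1` (see the module docstring). [cite: SilvermanAEC2009, III.2.3] -/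
theorem gal₄Y : (ζ ^ 4) ^ 2 - (ζ ^ 4) ^ 5 - (ζ ^ 4) ^ 4 = ζ ^ 5 + ζ ^ 4 + ζ ^ 3 + 2 * ζ + 1 := by
  linear_combination (-ζ ^ 14 + ζ ^ 13 - ζ ^ 10 + ζ ^ 9 - ζ ^ 7 + ζ ^ 6 - ζ ^ 3 + 2 * ζ ^ 2 - ζ - 1) * hΦ
/-- Galois action `ζ ↦ ζ⁵`: `x₁(ζ⁵) = x₄` (target `−P₄`). [cite: SilvermanAEC2009, III.§7] -/
theorem gal₅X : (ζ ^ 5) ^ 4 + (ζ ^ 5) ^ 3 = -ζ ^ 5 - ζ ^ 4 - ζ ^ 3 - ζ ^ 2 - 1 := by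
  linear_combination (ζ ^ 14 - ζ ^ 13 + ζ ^ 9 - ζ ^ 8 + ζ ^ 7 - ζ ^ 6 + ζ ^ 2 - ζ + 1) * hΦ
/-- `gal₅Y`: explicit identity / group-law step on `49a1 : y² + xy = x³ − x² − 2x − 1` (see the module docstring). [cite: SilvermanAEC2009, III.2.3] -/
theorem gal₅Y : (ζ ^ 5) ^ 2 - (ζ ^ 5) ^ 5 - (ζ ^ 5) ^ 4 = -(ζ ^ 4 - ζ ^ 3 - ζ) - (-ζ ^ 5 - ζ ^ 4 - ζ ^ 3 - ζ ^ 2 - 1) := by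
  linear_combination (-ζ ^ 19 + ζ ^ 18 - ζ ^ 14 + ζ ^ 13 - ζ ^ 12 + ζ ^ 11 - ζ ^ 7 + ζ ^ 6 - ζ ^ 5 + 2 * ζ ^ 4 - ζ ^ 3 - 1) * hΦ
/-- Galois action `ζ ↦ ζ⁶`: `x₁(ζ⁶) = x₁` (target `−P₁`). [cite: SilvermanAEC2009, III.§7] -/
theorem gal₆X : (ζ ^ 6) ^ 4 + (ζ ^ 6) ^ 3 = ζ ^ 4 + ζ ^ 3 := by
  linear_combination (ζ ^ 18 - ζ ^ 17 + ζ ^ 12 - ζ ^ 10 + ζ ^ 5 - ζ ^ 3) * hΦ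
/-- `gal₆Y`: explicit identity / group-law step on `49a1 : y² + xy = x³ − x² − 2x − 1` (see the module docstring). [cite: SilvermanAEC2009, III.2.3] -/
theorem gal₆Y : (ζ ^ 6) ^ 2 - (ζ ^ 6) ^ 5 - (ζ ^ 6) ^ 4 = -(ζ ^ 2 - ζ ^ 5 - ζ ^ 4) - (ζ ^ 4 + ζ ^ 3) := by
  linear_combination (-ζ ^ 24 + ζ ^ 23 - ζ ^ 18 + ζ ^ 16 - ζ ^ 11 + ζ ^ 9 + ζ ^ 6 - ζ ^ 5 - ζ ^ 4 + ζ ^ 2) * hΦ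

/-- Doubling certificate `2P₂ = P₄`, `x`-part. [cite: SilvermanAEC2009, III.2.3 (duplication formula)] -/
theorem dbl₂₄X : (3 * (ζ ^ 5 + ζ ^ 2) ^ 2 - 2 * (ζ ^ 5 + ζ ^ 2) - 2 - (ζ ^ 5 + ζ ^ 4 + ζ ^ 3 + 2 * ζ + 1)) ^ 2
    + (3 * (ζ ^ 5 + ζ ^ 2) ^ 2 - 2 * (ζ ^ 5 + ζ ^ 2) - 2 - (ζ ^ 5 + ζ ^ 4 + ζ ^ 3 + 2 * ζ + 1))
      * (2 * (ζ ^ 5 + ζ ^ 4 + ζ ^ 3 + 2 * ζ + 1) + (ζ ^ 5 + ζ ^ 2))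
    + (1 - 2 * (ζ ^ 5 + ζ ^ 2)) * (2 * (ζ ^ 5 + ζ ^ 4 + ζ ^ 3 + 2 * ζ + 1) + (ζ ^ 5 + ζ ^ 2)) ^ 2
    = (-ζ ^ 5 - ζ ^ 4 - ζ ^ 3 - ζ ^ 2 - 1) * (2 * (ζ ^ 5 + ζ ^ 4 + ζ ^ 3 + 2 * ζ + 1) + (ζ ^ 5 + ζ ^ 2)) ^ 2 := by
  linear_combination (9 * ζ ^ 14 - 9 * ζ ^ 13 + 36 * ζ ^ 11 - 36 * ζ ^ 10 - 18 * ζ ^ 9 + 69 * ζ ^ 8 - 37 * ζ ^ 7 - 36 * ζ ^ 6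
    + 44 * ζ ^ 5 + 18 * ζ ^ 4 - 21 * ζ ^ 3 + 9 * ζ ^ 2 + 17 * ζ + 11) * hΦ

/-- Doubling certificate `2P₂ = P₄`, `y`-part. [cite: SilvermanAEC2009, III.2.3 (duplication formula)] -/
theorem dbl₂₄Y : -((3 * (ζ ^ 5 + ζ ^ 2) ^ 2 - 2 * (ζ ^ 5 + ζ ^ 2) - 2 - (ζ ^ 5 + ζ ^ 4 + ζ ^ 3 + 2 * ζ + 1))
      * ((-ζ ^ 5 - ζ ^ 4 - ζ ^ 3 - ζ ^ 2 - 1) - (ζ ^ 5 + ζ ^ 2))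
      + (ζ ^ 5 + ζ ^ 4 + ζ ^ 3 + 2 * ζ + 1) * (2 * (ζ ^ 5 + ζ ^ 4 + ζ ^ 3 + 2 * ζ + 1) + (ζ ^ 5 + ζ ^ 2)))
    - (-ζ ^ 5 - ζ ^ 4 - ζ ^ 3 - ζ ^ 2 - 1) * (2 * (ζ ^ 5 + ζ ^ 4 + ζ ^ 3 + 2 * ζ + 1) + (ζ ^ 5 + ζ ^ 2))
    = (ζ ^ 4 - ζ ^ 3 - ζ) * (2 * (ζ ^ 5 + ζ ^ 4 + ζ ^ 3 + 2 * ζ + 1) + (ζ ^ 5 + ζ ^ 2)) := by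
  linear_combination (6 * ζ ^ 9 - 3 * ζ ^ 8 + 15 * ζ ^ 6 - 12 * ζ ^ 5 - 3 * ζ ^ 4 + 7 * ζ ^ 3 - 6 * ζ ^ 2 - ζ - 3) * hΦ

/-- Doubling certificate `2P₄ = P₁`, `x`-part (so `8P₁ = P₁`). [cite: SilvermanAEC2009, III.2.3 (duplication formula)] -/
theorem dbl₄₁X : (3 * (-ζ ^ 5 - ζ ^ 4 - ζ ^ 3 - ζ ^ 2 - 1) ^ 2 - 2 * (-ζ ^ 5 - ζ ^ 4 - ζ ^ 3 - ζ ^ 2 - 1) - 2 - (ζ ^ 4 - ζ ^ 3 - ζ)) ^ 2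
    + (3 * (-ζ ^ 5 - ζ ^ 4 - ζ ^ 3 - ζ ^ 2 - 1) ^ 2 - 2 * (-ζ ^ 5 - ζ ^ 4 - ζ ^ 3 - ζ ^ 2 - 1) - 2 - (ζ ^ 4 - ζ ^ 3 - ζ))
      * (2 * (ζ ^ 4 - ζ ^ 3 - ζ) + (-ζ ^ 5 - ζ ^ 4 - ζ ^ 3 - ζ ^ 2 - 1))
    + (1 - 2 * (-ζ ^ 5 - ζ ^ 4 - ζ ^ 3 - ζ ^ 2 - 1)) * (2 * (ζ ^ 4 - ζ ^ 3 - ζ) + (-ζ ^ 5 - ζ ^ 4 - ζ ^ 3 - ζ ^ 2 - 1)) ^ 2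
    = (ζ ^ 4 + ζ ^ 3) * (2 * (ζ ^ 4 - ζ ^ 3 - ζ) + (-ζ ^ 5 - ζ ^ 4 - ζ ^ 3 - ζ ^ 2 - 1)) ^ 2 := by
  linear_combination (9 * ζ ^ 14 + 27 * ζ ^ 13 + 54 * ζ ^ 12 + 90 * ζ ^ 11 + 99 * ζ ^ 10 + 128 * ζ ^ 9 + 121 * ζ ^ 8 + 124 * ζ ^ 7
    + 112 * ζ ^ 6 + 67 * ζ ^ 5 + 82 * ζ ^ 4 + 18 * ζ ^ 3 + 45 * ζ ^ 2 + 2 * ζ + 9) * hΦ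

/-- Doubling certificate `2P₄ = P₁`, `y`-part. [cite: SilvermanAEC2009, III.2.3 (duplication formula)] -/
theorem dbl₄₁Y : -((3 * (-ζ ^ 5 - ζ ^ 4 - ζ ^ 3 - ζ ^ 2 - 1) ^ 2 - 2 * (-ζ ^ 5 - ζ ^ 4 - ζ ^ 3 - ζ ^ 2 - 1) - 2 - (ζ ^ 4 - ζ ^ 3 - ζ))
      * ((ζ ^ 4 + ζ ^ 3) - (-ζ ^ 5 - ζ ^ 4 - ζ ^ 3 - ζ ^ 2 - 1))
      + (ζ ^ 4 - ζ ^ 3 - ζ) * (2 * (ζ ^ 4 - ζ ^ 3 - ζ) + (-ζ ^ 5 - ζ ^ 4 - ζ ^ 3 - ζ ^ 2 - 1)))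
    - (ζ ^ 4 + ζ ^ 3) * (2 * (ζ ^ 4 - ζ ^ 3 - ζ) + (-ζ ^ 5 - ζ ^ 4 - ζ ^ 3 - ζ ^ 2 - 1))
    = (ζ ^ 2 - ζ ^ 5 - ζ ^ 4) * (2 * (ζ ^ 4 - ζ ^ 3 - ζ) + (-ζ ^ 5 - ζ ^ 4 - ζ ^ 3 - ζ ^ 2 - 1)) := by
  linear_combination (-3 * ζ ^ 9 - 9 * ζ ^ 8 - 15 * ζ ^ 7 - 18 * ζ ^ 6 - 12 * ζ ^ 5 - 12 * ζ ^ 4 - 3 * ζ ^ 3 - 10 * ζ ^ 2 + ζ - 3) * hΦ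

end Zeta

/-! ### §3 Frobenius on an explicit point and the congruence `a_p ≡ p⁵ + p² (mod 7)` -/

section Frob

variable {p : ℕ} [Fact p.Prime]

/-- Frobenius on an explicit point of `W(\bar 𝔽_p)`: an `𝔽_p`-algebra map acting as `x ↦ x^p` sends `(x, y)` to `(x^p, y^p)`.
[cite: SilvermanAEC2009, V.§2 (the `q`-power Frobenius)] -/
theorem map_some_of_pow {W : WeierstrassCurve (ZMod p)} {f : AlgebraicClosure (ZMod p) →ₐ[ZMod p] AlgebraicClosure (ZMod p)}
    (hf : ∀ x, f x = x ^ p) {x y x' y' : AlgebraicClosure (ZMod p)}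
    (h : (W.baseChange (AlgebraicClosure (ZMod p))).toAffine.Nonsingular x y)
    (h' : (W.baseChange (AlgebraicClosure (ZMod p))).toAffine.Nonsingular x' y')
    (hx : x ^ p = x') (hy : y ^ p = y') :
    Affine.Point.map f (Affine.Point.some x y h) = Affine.Point.some x' y' h' := by
  rw [Affine.Point.map_some]
  exact pt_eq (by rw [← hx]; exact hf x) (by rw [← hy]; exact hf y)

end Frob

end SevenTorsion

open _root_.WeierstrassCurve Literature.NumberTheory.EllipticCurves.SqrtTwoTwist.EightTorsion SevenTorsion
  Literature.NumberTheory.Automorphic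

/-- ★ **The sign in Deuring's theorem for `X₀(49)`: `a_p(E) ≡ p⁵ + p² (mod 7)`** for every prime `p ≠ 2, 7`, `E = 49a1 = ⟨1, −1, 0, −2, −1⟩`,
`a_p = p + 1 − #E(𝔽_p)` (the tree's `frobeniusTrace`).  Tabulated: `a_p mod 7 = 2, 1, 0, 4, 0, 0` for `p mod 7 = 1, 2, 3, 4, 5, 6`.
PROOF (the `√−7`-torsion Frobenius argument, module docstring): over `\bar 𝔽_p` the explicit point `P₁ ∈ E[√−7]` has order `7`
(`2P₁ = P₂`, `2P₂ = P₄`, `2P₄ = P₁`), the `p`-Frobenius acts by `σP₁ = k P₁` with `k ≡ p⁻¹ (mod 7)` (Galois identities `gal_rX/Y` at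
`ζ ↦ ζ^p = ζ^{p mod 7}`), and Manin's pointwise relation `σ²P₁ − a_p σP₁ + pP₁ = O`
(`WeierstrassCurve.frobenius_sq_sub_trace_smul_add_card_smul`) gives `7 ∣ k² − a_p k + p`.
[cite: SilvermanAEC2009, Thm. V.2.3.1(b)] [cite: Rajwade1977, Thm 3] [cite: Silverberg2010, (2.1)] -/
theorem frobeniusTrace_E_mod_seven {p : ℕ} (hp : p.Prime) (hp2 : p ≠ 2) (hp7 : p ≠ 7) :
    Automorphic.frobeniusTrace E p % 7 = if p % 7 = 1 then 2 else if p % 7 = 2 then 1 else if p % 7 = 4 then 4 else 0 := by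
  haveI := Fact.mk hp
  haveI : Fact (Nat.Prime 7) := ⟨by norm_num⟩
  have hpodd : Odd p := hp.odd_of_ne_two hp2
  set W : WeierstrassCurve (ZMod p) := E.map (Int.castRingHom (ZMod p)) with hW
  -- `7 ≠ 0` in `𝔽_p` and `\bar 𝔽_p`
  have h7K : (7 : ZMod p) ≠ 0 := by
    intro h
    have h' : ((7 : ℕ) : ZMod p) = 0 := by exact_mod_cast h
    rw [ZMod.natCast_eq_zero_iff] at h'
    exact hp7 ((Nat.prime_dvd_prime_iff_eq hp (by norm_num)).mp h')
  have h7 : (7 : AlgebraicClosure (ZMod p)) ≠ 0 := by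
    rw [← map_ofNat (algebraMap (ZMod p) (AlgebraicClosure (ZMod p))) 7]
    exact (map_ne_zero _).mpr h7K
  -- the `a`-invariants of `W / \bar 𝔽_p`
  have ha : (W.baseChange (AlgebraicClosure (ZMod p))).a₁ = 1 ∧ (W.baseChange (AlgebraicClosure (ZMod p))).a₂ = -1 ∧
      (W.baseChange (AlgebraicClosure (ZMod p))).a₃ = 0 ∧ (W.baseChange (AlgebraicClosure (ZMod p))).a₄ = -2 ∧
      (W.baseChange (AlgebraicClosure (ZMod p))).a₆ = -1 := by
    simp only [hW, E, WeierstrassCurve.baseChange, WeierstrassCurve.map_a₁, WeierstrassCurve.map_a₂, WeierstrassCurve.map_a₃,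
      WeierstrassCurve.map_a₄, WeierstrassCurve.map_a₆, map_one, map_neg, map_zero, map_ofNat]
    exact ⟨trivial, trivial, trivial, trivial, trivial⟩
  obtain ⟨h₁, h₂, h₃, h₄, h₆⟩ := ha
  haveI hEll : W.IsElliptic := by
    refine ⟨isUnit_iff_ne_zero.mpr ?_⟩
    rw [hW, WeierstrassCurve.map_Δ, E_Δ]
    intro h
    apply h7K
    have h' : ((7 : ZMod p)) ^ 3 = 0 := by
      have : (Int.castRingHom (ZMod p)) (-343) = -(7 : ZMod p) ^ 3 := by rw [map_neg, map_ofNat]; norm_num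
      rw [this, neg_eq_zero] at h; exact h
    exact pow_eq_zero_iff (n := 3) (by norm_num) |>.mp h'
  -- a root of `Φ₇` in `\bar 𝔽_p`
  obtain ⟨ζ, hζ⟩ := IsAlgClosed.exists_root (Polynomial.cyclotomic 7 (AlgebraicClosure (ZMod p)))
    (by rw [Polynomial.degree_cyclotomic, Nat.totient_prime (by norm_num)]; norm_num)
  have hΦ : ζ ^ 6 + ζ ^ 5 + ζ ^ 4 + ζ ^ 3 + ζ ^ 2 + ζ + 1 = 0 := by
    rw [Polynomial.IsRoot, Polynomial.cyclotomic_prime, Polynomial.eval_finsetSum] at hζ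
    simp only [Polynomial.eval_pow, Polynomial.eval_X, Finset.sum_range_succ, Finset.sum_range_zero, zero_add, pow_zero,
      pow_one] at hζ
    linear_combination hζ
  have hζ7 : ζ ^ 7 = 1 := zeta_pow_seven hΦ
  -- the arithmetic Frobenius
  obtain ⟨σ, hσ⟩ := WeierstrassCurve.exists_frobenius_absoluteGaloisGroup (ZMod p)
  have hσ' : ∀ x : AlgebraicClosure (ZMod p), σ • x = x ^ p := fun x ↦ by rw [hσ, Nat.card_zmod]
  set f : AlgebraicClosure (ZMod p) →ₐ[ZMod p] AlgebraicClosure (ZMod p) :=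
    ((show AlgebraicClosure (ZMod p) ≃ₐ[ZMod p] AlgebraicClosure (ZMod p) from σ) :
      AlgebraicClosure (ZMod p) →ₐ[ZMod p] AlgebraicClosure (ZMod p)) with hf
  have hfx : ∀ x, f x = x ^ p := fun x ↦ hσ' x
  have hsmul : ∀ P : W.geomPoints, σ • P = Affine.Point.map f P := fun P ↦ rfl
  -- the three points of `E[√−7]`
  have hns : ∀ x y : AlgebraicClosure (ZMod p), y ^ 2 + x * y = x ^ 3 - x ^ 2 - 2 * x - 1 →
      (W.baseChange (AlgebraicClosure (ZMod p))).toAffine.Nonsingular x y :=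
    fun x y h ↦ SevenTorsion.nonsingular_of_eq h₁ h₂ h₃ h₄ h₆ h7 h
  set P₁ : W.geomPoints := Affine.Point.some (ζ ^ 4 + ζ ^ 3) (ζ ^ 2 - ζ ^ 5 - ζ ^ 4) (hns _ _ (onCurve₁ hΦ)) with hP₁
  set P₂ : W.geomPoints := Affine.Point.some (ζ ^ 5 + ζ ^ 2) (ζ ^ 5 + ζ ^ 4 + ζ ^ 3 + 2 * ζ + 1) (hns _ _ (onCurve₂ hΦ)) with hP₂
  set P₄ : W.geomPoints := Affine.Point.some (-ζ ^ 5 - ζ ^ 4 - ζ ^ 3 - ζ ^ 2 - 1) (ζ ^ 4 - ζ ^ 3 - ζ) (hns _ _ (onCurve₄ hΦ))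
    with hP₄
  -- doublings `2P₁ = P₂`, `2P₂ = P₄`, `2P₄ = P₁`
  have hD₁ : 2 * (ζ ^ 2 - ζ ^ 5 - ζ ^ 4) + (ζ ^ 4 + ζ ^ 3) ≠ 0 := by
    intro h; have e := D₁_mul hΦ; rw [h, zero_mul] at e; exact h7 e.symm
  have hD₂ : 2 * (ζ ^ 5 + ζ ^ 4 + ζ ^ 3 + 2 * ζ + 1) + (ζ ^ 5 + ζ ^ 2) ≠ 0 := by
    intro h; have e := D₂_mul hΦ; rw [h, zero_mul] at e; exact h7 e.symm
  have hD₄ : 2 * (ζ ^ 4 - ζ ^ 3 - ζ) + (-ζ ^ 5 - ζ ^ 4 - ζ ^ 3 - ζ ^ 2 - 1) ≠ 0 := by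
    intro h; have e := D₄_mul hΦ; rw [h, zero_mul] at e; exact h7 e.symm
  have h12 : P₁ + P₁ = P₂ := add_self_of_cert h₁ h₂ h₃ h₄ _ _ hD₁ (dbl₁₂X hΦ) (dbl₁₂Y hΦ)
  have h24 : P₂ + P₂ = P₄ := add_self_of_cert h₁ h₂ h₃ h₄ _ _ hD₂ (dbl₂₄X hΦ) (dbl₂₄Y hΦ)
  have h41 : P₄ + P₄ = P₁ := add_self_of_cert h₁ h₂ h₃ h₄ _ _ hD₄ (dbl₄₁X hΦ) (dbl₄₁Y hΦ)
  have h2 : (2 : ℤ) • P₁ = P₂ := by rw [two_zsmul]; exact h12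
  have h4 : (4 : ℤ) • P₁ = P₄ := by rw [show (4 : ℤ) = 2 * 2 by norm_num, mul_zsmul, h2, two_zsmul]; exact h24
  have h7P : (7 : ℤ) • P₁ = 0 := by
    have h8 : (8 : ℤ) • P₁ = P₁ := by rw [show (8 : ℤ) = 2 * 4 by norm_num, mul_zsmul, h4, two_zsmul]; exact h41
    rw [show (7 : ℤ) • P₁ = (8 : ℤ) • P₁ - P₁ by module, h8, sub_self]
  have hP0 : P₁ ≠ 0 := Affine.Point.some_ne_zero _
  have ho : addOrderOf P₁ = 7 :=
    addOrderOf_eq_prime (by rw [← natCast_zsmul]; exact_mod_cast h7P) hP0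
  have zP := zsmul_eq_zero_iff_of_addOrderOf ho
  push_cast at zP
  -- negatives
  have eN1 : (-(ζ ^ 2 - ζ ^ 5 - ζ ^ 4) - (ζ ^ 4 + ζ ^ 3)) ^ 2 + (ζ ^ 4 + ζ ^ 3) * (-(ζ ^ 2 - ζ ^ 5 - ζ ^ 4) - (ζ ^ 4 + ζ ^ 3)) =
      (ζ ^ 4 + ζ ^ 3) ^ 3 - (ζ ^ 4 + ζ ^ 3) ^ 2 - 2 * (ζ ^ 4 + ζ ^ 3) - 1 := by linear_combination onCurve₁ hΦ
  have eN2 : (-(ζ ^ 5 + ζ ^ 4 + ζ ^ 3 + 2 * ζ + 1) - (ζ ^ 5 + ζ ^ 2)) ^ 2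
      + (ζ ^ 5 + ζ ^ 2) * (-(ζ ^ 5 + ζ ^ 4 + ζ ^ 3 + 2 * ζ + 1) - (ζ ^ 5 + ζ ^ 2)) =
      (ζ ^ 5 + ζ ^ 2) ^ 3 - (ζ ^ 5 + ζ ^ 2) ^ 2 - 2 * (ζ ^ 5 + ζ ^ 2) - 1 := by linear_combination onCurve₂ hΦ
  have eN4 : (-(ζ ^ 4 - ζ ^ 3 - ζ) - (-ζ ^ 5 - ζ ^ 4 - ζ ^ 3 - ζ ^ 2 - 1)) ^ 2
      + (-ζ ^ 5 - ζ ^ 4 - ζ ^ 3 - ζ ^ 2 - 1) * (-(ζ ^ 4 - ζ ^ 3 - ζ) - (-ζ ^ 5 - ζ ^ 4 - ζ ^ 3 - ζ ^ 2 - 1)) =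
      (-ζ ^ 5 - ζ ^ 4 - ζ ^ 3 - ζ ^ 2 - 1) ^ 3 - (-ζ ^ 5 - ζ ^ 4 - ζ ^ 3 - ζ ^ 2 - 1) ^ 2
        - 2 * (-ζ ^ 5 - ζ ^ 4 - ζ ^ 3 - ζ ^ 2 - 1) - 1 := by linear_combination onCurve₄ hΦ
  have hneg1 : -P₁ = Affine.Point.some (ζ ^ 4 + ζ ^ 3) (-(ζ ^ 2 - ζ ^ 5 - ζ ^ 4) - (ζ ^ 4 + ζ ^ 3)) (hns _ _ eN1) :=
    neg_pt h₁ h₃ _ _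
  have hneg2 : -P₂ = Affine.Point.some (ζ ^ 5 + ζ ^ 2) (-(ζ ^ 5 + ζ ^ 4 + ζ ^ 3 + 2 * ζ + 1) - (ζ ^ 5 + ζ ^ 2)) (hns _ _ eN2) :=
    neg_pt h₁ h₃ _ _
  have hneg4 : -P₄ = Affine.Point.some (-ζ ^ 5 - ζ ^ 4 - ζ ^ 3 - ζ ^ 2 - 1)
      (-(ζ ^ 4 - ζ ^ 3 - ζ) - (-ζ ^ 5 - ζ ^ 4 - ζ ^ 3 - ζ ^ 2 - 1)) (hns _ _ eN4) := neg_pt h₁ h₃ _ _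
  have h6 : (6 : ℤ) • P₁ = -P₁ := by
    rw [eq_neg_iff_add_eq_zero, ← add_one_zsmul]; norm_num; exact h7P
  have h5 : (5 : ℤ) • P₁ = -P₂ := by
    rw [eq_neg_iff_add_eq_zero, ← h2, ← add_zsmul]; norm_num; exact h7P
  have h3 : (3 : ℤ) • P₁ = -P₄ := by
    rw [eq_neg_iff_add_eq_zero, ← h4, ← add_zsmul]; norm_num; exact h7P
  -- Frobenius on `P₁`: coordinates
  have hζp : ζ ^ p = ζ ^ (p % 7) := by
    rw [show ζ ^ p = ζ ^ (7 * (p / 7) + p % 7) by rw [Nat.div_add_mod], pow_add, pow_mul, hζ7, one_pow, one_mul]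
  have hxp : (ζ ^ 4 + ζ ^ 3) ^ p = (ζ ^ (p % 7)) ^ 4 + (ζ ^ (p % 7)) ^ 3 := by
    rw [add_pow_char _ _ p, ← pow_mul, ← pow_mul, mul_comm 4 p, mul_comm 3 p, pow_mul, pow_mul, hζp]
  have hyp : (ζ ^ 2 - ζ ^ 5 - ζ ^ 4) ^ p = (ζ ^ (p % 7)) ^ 2 - (ζ ^ (p % 7)) ^ 5 - (ζ ^ (p % 7)) ^ 4 := by
    rw [sub_pow_char, sub_pow_char, ← pow_mul, ← pow_mul, ← pow_mul, mul_comm 2 p, mul_comm 5 p, mul_comm 4 p,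
      pow_mul, pow_mul, pow_mul, hζp]
  have hσgen : ∀ (x' y' : AlgebraicClosure (ZMod p)) (h' : (W.baseChange (AlgebraicClosure (ZMod p))).toAffine.Nonsingular x' y'),
      (ζ ^ (p % 7)) ^ 4 + (ζ ^ (p % 7)) ^ 3 = x' → (ζ ^ (p % 7)) ^ 2 - (ζ ^ (p % 7)) ^ 5 - (ζ ^ (p % 7)) ^ 4 = y' →
      σ • P₁ = Affine.Point.some x' y' h' := by
    intro x' y' h' hx hy
    rw [hsmul, hP₁]
    exact map_some_of_pow hfx _ _ (hxp.trans hx) (hyp.trans hy)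
  -- `σ P₁ = k P₁`, `k ≡ p⁻¹ (mod 7)`
  have hr : p % 7 = 1 ∨ p % 7 = 2 ∨ p % 7 = 3 ∨ p % 7 = 4 ∨ p % 7 = 5 ∨ p % 7 = 6 := by
    have h0 : p % 7 ≠ 0 := fun h ↦ hp7 ((Nat.prime_dvd_prime_iff_eq (by norm_num : Nat.Prime 7) hp).mp
      (Nat.dvd_of_mod_eq_zero h)).symm
    omega
  obtain ⟨k, hkv, hk7, hσP⟩ : ∃ k : ℤ, (k = 1 ∨ k = 4 ∨ k = 5 ∨ k = 2 ∨ k = 3 ∨ k = 6) ∧ (k * (p : ℤ)) % 7 = 1 ∧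
      σ • P₁ = k • P₁ := by
    rcases hr with h | h | h | h | h | h
    · refine ⟨1, by norm_num, by omega, ?_⟩
      rw [one_zsmul, hP₁]
      exact hσgen _ _ _ (by rw [h, pow_one]) (by rw [h, pow_one])
    · refine ⟨4, by norm_num, by omega, ?_⟩
      rw [h4]
      exact hσgen _ _ _ (by rw [h]; exact gal₂X hΦ) (by rw [h]; exact gal₂Y hΦ)
    · refine ⟨5, by norm_num, by omega, ?_⟩
      rw [h5, hneg2]
      exact hσgen _ _ _ (by rw [h]; exact gal₃X hΦ) (by rw [h]; exact gal₃Y hΦ)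
    · refine ⟨2, by norm_num, by omega, ?_⟩
      rw [h2]
      exact hσgen _ _ _ (by rw [h]; exact gal₄X hΦ) (by rw [h]; exact gal₄Y hΦ)
    · refine ⟨3, by norm_num, by omega, ?_⟩
      rw [h3, hneg4]
      exact hσgen _ _ _ (by rw [h]; exact gal₅X hΦ) (by rw [h]; exact gal₅Y hΦ)
    · refine ⟨6, by norm_num, by omega, ?_⟩
      rw [h6, hneg1]
      exact hσgen _ _ _ (by rw [h]; exact gal₆X hΦ) (by rw [h]; exact gal₆Y hΦ)
  -- Manin's relation at `P₁`
  have hM := WeierstrassCurve.frobenius_sq_sub_trace_smul_add_card_smul W hσ P₁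
  rw [ZMod.card, hσP] at hM
  have hσk : σ • (k • P₁) = k • (σ • P₁) := map_zsmul (DistribSMul.toAddMonoidHom W.geomPoints σ) k P₁
  rw [hσk, hσP] at hM
  have key : (k * k - HasseManin.tr W * k + p) • P₁ = 0 := by
    rw [show (k * k - HasseManin.tr W * k + p) • P₁ = k • k • P₁ - HasseManin.tr W • k • P₁ + (p : ℤ) • P₁ by module]
    exact hM
  rw [zP] at key
  -- `tr W = frobeniusTrace E p`
  have htr : HasseManin.tr W = Automorphic.frobeniusTrace E p := by
    unfold HasseManin.tr Automorphic.frobeniusTrace Automorphic.numPointsMod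
    rw [ZMod.card]
  rw [← htr]
  -- arithmetic modulo `7`, case by case in `k`
  rcases hkv with rfl | rfl | rfl | rfl | rfl | rfl
  · have e : p % 7 = 1 := by omega
    rw [if_pos e]; omega
  · have e : p % 7 = 2 := by omega
    rw [if_neg (by omega), if_pos e]; omega
  · have e : p % 7 = 3 := by omega
    rw [if_neg (by omega), if_neg (by omega), if_neg (by omega)]; omega
  · have e : p % 7 = 4 := by omega
    rw [if_neg (by omega), if_neg (by omega), if_pos e]; omega
  · have e : p % 7 = 5 := by omega
    rw [if_neg (by omega), if_neg (by omega), if_neg (by omega)]; omega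
  · have e : p % 7 = 6 := by omega
    rw [if_neg (by omega), if_neg (by omega), if_neg (by omega)]; omega

end X049

end Literature.NumberTheory.EllipticCurves
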